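import Mathlib
import Summits.NavierStokesRegularity.NavierStokesRegularity.Theorems.EulerZoomLiouvillePowerGaugeEulerLiouvilleSelfSimilarVorticityTransport
import Summits.NavierStokesRegularity.NavierStokesRegularity.Theorems.EulerZoomLiouvillePowerGaugeEulerLiouvilleSelfSimilarBackwardTrajectories
import Literature.Analysis.FluidPDE.SelfSimilarEulerTrappedTrajectories
import HarnessLib.Audit

/-!
# Rung C1 of the crux `EulerZoomLiouville.PowerGaugeEulerLiouville`: the KILL step WITHOUT convergence —
# vorticity cannot emanate from a limit SET of good stagnation points

Route №10 `EulerZoomLiouville` (NavierStokesRegularity), crux E = stmt-NavierStokesRegularity-19832,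
tenure rung C1 (exactly self-similar members), registered residue `stub_selfSimilarExtremal`.
First file of the NODAL-CONTINUUM line (lineage ns-typeII-p1, gen 7), which attacks UNCOUNTABLE nodal
sets of a `C²` stationary self-similar Euler profile `(U, P)` (`IsSelfSimilarEulerProfile γ c U P`,
CIV 2026 (3.3); transport field `V = γ(y−c) + U`, vorticity `Ω = curl U`, nodal set `𝒩_V = {V = 0}`).

The nodal-finiteness / -countability chain (lineage ns-typeII-p2, `…SelfSimilarVorticityTransport` …
`…SelfSimilarCountableNodalSet`) kills the vorticity carried into a node `z` along a backward trajectory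
`Y` (`Y' = −V(Y)`) that CONVERGES to `z`, via an adapted quadratic form at `z`.  For an uncountable nodal
set a bounded backward trajectory need not converge.  This file removes the convergence hypothesis from
the KILL step, measuring stretching in the EUCLIDEAN metric — the tree's criterion `⟪DU(z)w, w⟫ < |w|²`
(`SelfSimilarEulerStagnationStretching`), which agrees with the spectral one at NON-VORTICAL nodes:

* `curl_comp_eq_zero_of_curl_comp_eq_zero` — flow invariance of `{Ω = 0}` along a backward trajectory
  (uniqueness for the linear equation `dΩ(Y)/dt = Ω(Y) − DU(Y)Ω(Y)`);
* `curl_comp_eq_zero_of_eventually_stretching_le` — **ORBIT KILL**: if along a bounded backward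
  trajectory EVENTUALLY `⟪DU(Y(t))w, w⟫ ≤ θ|w|²` with one `θ < 1`, then `Ω(Y(0)) = 0`.  Mechanism:
  `d/dt |Ω(Y)|² = 2(|Ω(Y)|² − ⟪DU(Y)Ω(Y), Ω(Y)⟫) ≥ 2(1−θ)|Ω(Y)|²` — the Euclidean norm is a universal
  Lyapunov function (the antisymmetric part of `DU` drops out of the quadratic form), so no adapted
  metric and no limit point are needed; `Ω(Y)` is bounded on the bounded trajectory, hence vanishes;
* `exists_mapClusterPt_stretching_ge_one` — **LIMIT-SET KILL** (`γ ≠ ½`): a bounded backward trajectory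
  through a VORTICAL point (`Ω(Y(0)) ≠ 0`) has a cluster point `z` which is a stagnation point carrying
  a unit vector `w` with `⟪DU(z)w, w⟫ ≥ 1` — a BAD node (compactness of (ball) × (unit sphere): were all
  cluster nodes good, the stretching along the trajectory would eventually be `≤ θ < 1`);
* `exists_badNode_mapClusterPt_of_curl_ne_zero` — the same for the global self-similar Lagrangian flow
  under the far field (3.8) (`γ > 0`), with the bad node ADHERENT TO THE VORTICAL REGION
  (`z ∈ closure {Ω ≠ 0}`, since the trajectory stays vortical);
* `exists_unit_stretching_eq_one_of_mem_nodalSet_of_curl_ne_zero` — vortical nodes are bad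
  (`DU(z)Ω(z) = Ω(z)`, CIV Thm 3.8), so the bad nodes are: all vortical nodes, and the non-vortical
  nodes whose (symmetric) `DU(z)` has top eigenvalue `≥ 1`.

Reading (no countability hypothesis): **every vortical fluid particle is backward-asymptotic to a bad
stagnation point**.  Sequel (`…SelfSimilarTopBadNode`): the top bad node adherent to the vortical region.

WHAT THIS IS NOT: not NS, not E, not rung C1 — Lagrangian bookkeeping for classical (`C²`) profiles.
References: P. Constantin, M. Ignatova, V. Vicol, arXiv:2602.17570 (2026), §3.1.1 (3.4), §3.4.1
(3.21)–(3.22), §3.4.3 (3.31)–(3.33), §3.5 Thms 3.8, 3.10. [ConstantinIgnatovaVicol2026Putative]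
-/

noncomputable section

-- flat `Theorems/<Route><Decl>…` files of one crux share the namespace of the crux (tree convention)
set_option linter.dupNamespace false

open Set Filter Topology Metric Function InnerProductSpace
open scoped RealInnerProductSpace NNReal

namespace Summit.NavierStokesRegularity.NavierStokesRegularity.Theorems.PowerGaugeEulerLiouville.NodalContinuum

open Literature.Analysis Literature.Analysis.FluidPDE Literature.Analysis.ODE
open Summit.NavierStokesRegularity.NavierStokesRegularity.Theorems.PowerGaugeEulerLiouville.NodalFiniteness

variable {γ C : ℝ} {c : EuclideanSpace ℝ (Fin 3)}
  {U : EuclideanSpace ℝ (Fin 3) → EuclideanSpace ℝ (Fin 3)} {P : EuclideanSpace ℝ (Fin 3) → ℝ}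

/-! ### Continuity and compactness bookkeeping -/

/-- `(y, w) ↦ ⟪DU(y) w, w⟫` is continuous for a `C²` profile. [cite: ConstantinIgnatovaVicol2026Putative, §3.1.1 eq. (3.3)] -/
theorem continuous_stretchingForm (h : IsSelfSimilarEulerProfile γ c U P) :
    Continuous fun p : EuclideanSpace ℝ (Fin 3) × EuclideanSpace ℝ (Fin 3) =>
      ⟪fderiv ℝ U p.1 p.2, p.2⟫ := by
  have hDU : Continuous fun y => fderiv ℝ U y := h.contDiff_velocity.continuous_fderiv (by norm_num)
  exact ((hDU.comp continuous_fst).clm_apply continuous_snd).inner continuous_snd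

/-- On a bounded backward trajectory the vorticity is bounded (continuity of `curl U` on the compact
confining ball). [cite: ConstantinIgnatovaVicol2026Putative, §3.1.1 eq. (3.4)] -/
theorem exists_bound_curl_comp (h : IsSelfSimilarEulerProfile γ c U P)
    {Y : ℝ → EuclideanSpace ℝ (Fin 3)} {B : ℝ} (hB : ∀ t, 0 ≤ t → ‖Y t‖ ≤ B) :
    ∃ M, 0 ≤ M ∧ ∀ t, 0 ≤ t → ‖curl U (Y t)‖ ≤ M := by
  have hcurlc : Continuous (curl U) :=
    h.isSelfSimilarEulerVorticityProfile.differentiable_curl.continuous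
  obtain ⟨M, hM⟩ := (isCompact_closedBall (0 : EuclideanSpace ℝ (Fin 3)) B).exists_bound_of_continuousOn
    hcurlc.continuousOn
  refine ⟨max M 0, le_max_right _ _, fun t ht => ?_⟩
  exact (hM _ (mem_closedBall_zero_iff.2 (hB t ht))).trans (le_max_left _ _)

/-- On a ball the transport gradient `DV` is bounded. [cite: ConstantinIgnatovaVicol2026Putative, §3.4 eq. (3.19)] -/
theorem exists_bound_fderiv_transport (h : IsSelfSimilarEulerProfile γ c U P) (B : ℝ) :
    ∃ L, 0 ≤ L ∧ ∀ y ∈ closedBall (0 : EuclideanSpace ℝ (Fin 3)) B,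
      ‖fderiv ℝ (selfSimilarTransport γ c U) y‖ ≤ L := by
  obtain ⟨L, hL⟩ := (isCompact_closedBall (0 : EuclideanSpace ℝ (Fin 3)) B).exists_bound_of_continuousOn
    (continuous_fderiv_transport h).continuousOn
  exact ⟨max L 0, le_max_right _ _, fun y hy => (hL y hy).trans (le_max_left _ _)⟩

/-! ### Flow invariance of the irrotational set -/

/-- **`{Ω = 0}` is invariant along trajectories**: if a backward trajectory `Y` (`Y' = −V(Y)`, bounded
for `t ≥ 0`) has `Ω(Y(T)) = 0` at some `T ≥ 0`, then `Ω(Y(0)) = 0` (uniqueness for the linear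
equation `dΩ(Y)/dt = (1+γ)Ω(Y) − DV(Y)Ω(Y)` on `[0, T]`).
[cite: ConstantinIgnatovaVicol2026Putative, §3.4.1 eq. (3.22)] -/
theorem curl_comp_eq_zero_of_curl_comp_eq_zero (h : IsSelfSimilarEulerProfile γ c U P)
    {Y : ℝ → EuclideanSpace ℝ (Fin 3)}
    (hY : ∀ t, HasDerivAt Y ((-1 : ℝ) • selfSimilarTransport γ c U (Y t)) t)
    {B : ℝ} (hB : ∀ t, 0 ≤ t → ‖Y t‖ ≤ B) {T : ℝ} (hT : 0 ≤ T) (h0 : curl U (Y T) = 0) :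
    curl U (Y 0) = 0 := by
  set V := selfSimilarTransport γ c U with hV
  -- the linear field `A t v = -(DV(Y t) v - (1+γ) v)`
  set A : ℝ → EuclideanSpace ℝ (Fin 3) →L[ℝ] EuclideanSpace ℝ (Fin 3) :=
    fun t => (-1 : ℝ) • (fderiv ℝ V (Y t) - (1 + γ) • ContinuousLinearMap.id ℝ _) with hA
  set u : ℝ → EuclideanSpace ℝ (Fin 3) := fun s => curl U (Y s) with hu
  have hu' : ∀ t, HasDerivAt u (A t (u t)) t := by
    intro t
    have := hasDerivAt_curl_comp h (hY t)
    refine this.congr_deriv ?_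
    simp [hA, hu, hV]
  obtain ⟨L, hL0, hL⟩ := exists_bound_fderiv_transport h B
  have hKV : ∀ t ∈ Ioc 0 T, LipschitzOnWith (Real.toNNReal (L + |1 + γ|))
      (fun x : EuclideanSpace ℝ (Fin 3) => A t x) univ := by
    intro t ht
    refine ((A t).lipschitz.weaken ?_).lipschitzOnWith
    rw [← NNReal.coe_le_coe, coe_nnnorm, Real.coe_toNNReal _ (by positivity)]
    have hYt : Y t ∈ closedBall (0 : EuclideanSpace ℝ (Fin 3)) B :=
      mem_closedBall_zero_iff.2 (hB t ht.1.le)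
    calc ‖A t‖ = ‖fderiv ℝ V (Y t) - (1 + γ) • ContinuousLinearMap.id ℝ (EuclideanSpace ℝ (Fin 3))‖ := by
          simp only [hA]; rw [norm_smul, norm_neg, norm_one, one_mul]
      _ ≤ ‖fderiv ℝ V (Y t)‖ + ‖(1 + γ) • ContinuousLinearMap.id ℝ (EuclideanSpace ℝ (Fin 3))‖ :=
          norm_sub_le _ _
      _ ≤ L + |1 + γ| := by
          refine add_le_add (hL _ hYt) ?_
          rw [norm_smul, Real.norm_eq_abs]
          exact mul_le_of_le_one_right (abs_nonneg _) ContinuousLinearMap.norm_id_le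
  have hcont : ContinuousOn u (Icc 0 T) := fun t _ => (hu' t).continuousAt.continuousWithinAt
  have hEq : EqOn u (fun _ => (0 : EuclideanSpace ℝ (Fin 3))) (Icc 0 T) :=
    ODE_solution_unique_of_mem_Icc_left (v := fun t x => A t x) (s := fun _ => univ)
      hKV hcont (fun t _ => (hu' t).hasDerivWithinAt) (fun _ _ => mem_univ _)
      continuousOn_const
      (fun t _ => by
        have h0 : HasDerivWithinAt (fun _ : ℝ => (0 : EuclideanSpace ℝ (Fin 3))) 0 (Iic t) t :=
          hasDerivWithinAt_const _ _ _
        simpa using h0)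
      (fun _ _ => mem_univ _) (by simpa [hu] using h0)
  exact hEq ⟨le_rfl, hT⟩

/-! ### ORBIT KILL: the Euclidean norm as a universal Lyapunov function -/

/-- **`d/dt |Ω(Y)|² = 2(|Ω(Y)|² − ⟪DU(Y)Ω(Y), Ω(Y)⟫)` along a backward trajectory** `Y' = −V(Y)`
(from `dΩ(Y)/dt = (1+γ)Ω(Y) − DV(Y)Ω(Y)` and `DV = γI + DU`; the antisymmetric part of `DU` does not
contribute). [cite: ConstantinIgnatovaVicol2026Putative, §3.4.1 eq. (3.22)] -/
theorem hasDerivAt_norm_curl_comp_sq (h : IsSelfSimilarEulerProfile γ c U P)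
    {Y : ℝ → EuclideanSpace ℝ (Fin 3)} {t : ℝ}
    (hY : HasDerivAt Y ((-1 : ℝ) • selfSimilarTransport γ c U (Y t)) t) :
    HasDerivAt (fun s => ‖curl U (Y s)‖ ^ 2)
      (2 * (‖curl U (Y t)‖ ^ 2 - ⟪fderiv ℝ U (Y t) (curl U (Y t)), curl U (Y t)⟫)) t := by
  have h1 := (hasDerivAt_curl_comp h hY).norm_sq
  refine h1.congr_deriv ?_
  congr 1
  rw [fderiv_transport_eq h (Y t)]
  simp only [add_apply, FunLike.coe_smul, Pi.smul_apply,
    ContinuousLinearMap.coe_id', id_eq, inner_smul_right, inner_sub_right, inner_add_right,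
    real_inner_self_eq_norm_sq]
  rw [real_inner_comm]
  ring

/-- **ORBIT KILL (no convergence needed).**  Let `(U, P)` be a `C²` self-similar Euler profile and `Y`
a backward self-similar trajectory (`Y' = −V(Y)`) bounded for `t ≥ 0`.  If from some time `T ≥ 0` on
`⟪DU(Y(t))w, w⟫ ≤ θ|w|²` for all `w` with one `θ < 1`, then `Ω(Y(0)) = 0`: `|Ω(Y)|²e^{−2(1−θ)t}` is
nondecreasing on `[T, ∞)` while `Ω(Y)` is bounded, so `Ω(Y(T)) = 0`, and `Ω(Y(0)) = 0` by flow
invariance.  No limit point and no adapted metric (cf. `curl_comp_eq_zero_of_tendsto_of_lowerCertificate`).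
[cite: ConstantinIgnatovaVicol2026Putative, §3.4.1 eq. (3.22) and §3.5 proof of Thm 3.10 (trajectory-wise, sharpened)] -/
theorem curl_comp_eq_zero_of_eventually_stretching_le (h : IsSelfSimilarEulerProfile γ c U P)
    {Y : ℝ → EuclideanSpace ℝ (Fin 3)}
    (hY : ∀ t, HasDerivAt Y ((-1 : ℝ) • selfSimilarTransport γ c U (Y t)) t)
    {B : ℝ} (hB : ∀ t, 0 ≤ t → ‖Y t‖ ≤ B) {θ : ℝ} (hθ : θ < 1) {T : ℝ} (hT : 0 ≤ T)
    (hstretch : ∀ t, T ≤ t → ∀ w : EuclideanSpace ℝ (Fin 3),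
      ⟪fderiv ℝ U (Y t) w, w⟫ ≤ θ * ‖w‖ ^ 2) :
    curl U (Y 0) = 0 := by
  set f : ℝ → ℝ := fun s => ‖curl U (Y s)‖ ^ 2 with hf
  set κ : ℝ := 2 * (1 - θ) with hκ
  have hκpos : 0 < κ := by rw [hκ]; linarith
  -- `g s = e^{-κ s} f s` is nondecreasing on `[T, ∞)`
  set g : ℝ → ℝ := fun s => Real.exp (-κ * s) * f s with hg
  have hg' : ∀ s, HasDerivAt g (Real.exp (-κ * s) *
      (2 * (‖curl U (Y s)‖ ^ 2 - ⟪fderiv ℝ U (Y s) (curl U (Y s)), curl U (Y s)⟫) - κ * f s)) s := by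
    intro s
    have he : HasDerivAt (fun s => Real.exp (-κ * s)) (Real.exp (-κ * s) * (-κ * 1)) s :=
      ((hasDerivAt_id s).const_mul (-κ)).exp
    have := he.mul (hasDerivAt_norm_curl_comp_sq h (hY s))
    refine this.congr_deriv ?_
    simp only [hf]
    ring
  have hgmono : MonotoneOn g (Ici T) := by
    refine monotoneOn_of_hasDerivWithinAt_nonneg (convex_Ici T)
      (fun s _ => (hg' s).continuousAt.continuousWithinAt)
      (fun s _ => (hg' s).hasDerivWithinAt) ?_
    intro s hs
    rw [interior_Ici] at hs
    have hsT : T ≤ s := le_of_lt hs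
    have hq := hstretch s hsT (curl U (Y s))
    have h1 : κ * f s ≤ 2 * (‖curl U (Y s)‖ ^ 2 - ⟪fderiv ℝ U (Y s) (curl U (Y s)), curl U (Y s)⟫) := by
      simp only [hf, hκ]
      nlinarith [hq, sq_nonneg ‖curl U (Y s)‖]
    exact mul_nonneg (Real.exp_pos _).le (by linarith)
  -- vorticity bound on the trajectory
  obtain ⟨M, hM0, hM⟩ := exists_bound_curl_comp h hB
  -- `f T ≤ e^{-κ (t - T)} M²` for all `t ≥ T`
  have hfT : ∀ t, T ≤ t → f T ≤ Real.exp (-κ * (t - T)) * M ^ 2 := by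
    intro t ht
    have h1 : g T ≤ g t := hgmono (mem_Ici.2 le_rfl) (mem_Ici.2 ht) ht
    simp only [hg] at h1
    have hft : f t ≤ M ^ 2 := by
      simp only [hf]
      have := hM t (hT.trans ht)
      exact pow_le_pow_left₀ (norm_nonneg _) this 2
    have h2 : Real.exp (-κ * t) * f t ≤ Real.exp (-κ * t) * M ^ 2 :=
      mul_le_mul_of_nonneg_left hft (Real.exp_pos _).le
    have h3 : Real.exp (-κ * T) * f T ≤ Real.exp (-κ * t) * M ^ 2 := h1.trans h2
    have h4 : Real.exp (-κ * (t - T)) * M ^ 2 = Real.exp (-κ * t) * M ^ 2 / Real.exp (-κ * T) := by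
      rw [show -κ * (t - T) = -κ * t - -κ * T by ring, Real.exp_sub]
      ring
    rw [h4, le_div_iff₀ (Real.exp_pos _)]
    linarith
  -- let `t → ∞`
  have hlim : Tendsto (fun t => Real.exp (-κ * (t - T)) * M ^ 2) atTop (𝓝 0) := by
    have h1 : Tendsto (fun t : ℝ => -κ * (t - T)) atTop atBot := by
      have : Tendsto (fun t : ℝ => t - T) atTop atTop := tendsto_atTop_add_const_right _ _ tendsto_id
      exact this.const_mul_atTop_of_neg (by linarith)
    have h2 := Real.tendsto_exp_atBot.comp h1
    simpa using h2.mul_const (M ^ 2)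
  have hfT0 : f T ≤ 0 :=
    le_of_tendsto_of_tendsto tendsto_const_nhds hlim
      ((eventually_ge_atTop T).mono fun t ht => hfT t ht)
  have hΩT : curl U (Y T) = 0 := by
    have : f T = 0 := le_antisymm hfT0 (by positivity)
    simpa [hf] using this
  exact curl_comp_eq_zero_of_curl_comp_eq_zero h hY hB hT hΩT

/-! ### LIMIT-SET KILL: a vortical trajectory accumulates at a bad node -/

/-- Cluster points of a bounded backward trajectory are stagnation points (`γ ≠ ½`; `V(Y(t)) → 0` by
Barbalat, tree `tendsto_transport_comp_of_bounded`). [cite: ConstantinIgnatovaVicol2026Putative, §3.4.3 eq. (3.33) and Rem. 3.6] -/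
theorem mem_nodalSet_of_mapClusterPt (h : IsSelfSimilarEulerProfile γ c U P) (hγ' : γ ≠ 1 / 2)
    {Y : ℝ → EuclideanSpace ℝ (Fin 3)}
    (hY : ∀ t, HasDerivAt Y ((-1 : ℝ) • selfSimilarTransport γ c U (Y t)) t)
    {B : ℝ} (hB : ∀ t, 0 ≤ t → ‖Y t‖ ≤ B) {z : EuclideanSpace ℝ (Fin 3)}
    (hz : MapClusterPt z atTop Y) : z ∈ selfSimilarNodalSet γ c U := by
  have hV0 := h.tendsto_transport_comp_of_bounded hγ' (by norm_num : (-1 : ℝ) ≠ 0) hY hB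
  have hVc : Continuous (selfSimilarTransport γ c U) := by
    have e : selfSimilarTransport γ c U = fun y => γ • (y - c) + U y := rfl
    rw [e]
    exact ((continuous_id.sub continuous_const).const_smul γ).add h.contDiff_velocity.continuous
  rw [mem_selfSimilarNodalSet_iff, ← selfSimilarTransport_apply]
  by_contra hne
  have hpos : 0 < ‖selfSimilarTransport γ c U z‖ := norm_pos_iff.2 hne
  -- near `z` the speed exceeds half its value at `z`; but eventually it is below that
  have hW : ∀ᶠ y in 𝓝 z, ‖selfSimilarTransport γ c U z‖ / 2 < ‖selfSimilarTransport γ c U y‖ := by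
    have hc : ContinuousAt (fun y => ‖selfSimilarTransport γ c U y‖) z := hVc.norm.continuousAt
    exact hc.eventually (lt_mem_nhds (by linarith))
  have hfreq := hz.frequently hW
  have hev : ∀ᶠ t in atTop, ‖selfSimilarTransport γ c U (Y t)‖ < ‖selfSimilarTransport γ c U z‖ / 2 :=
    (tendsto_zero_iff_norm_tendsto_zero.1 hV0).eventually (Iio_mem_nhds (by linarith))
  obtain ⟨t, h1, h2⟩ := (hfreq.and_eventually hev).exists
  linarith

/-- A cluster point of a trajectory staying in a set for `t ≥ 0` lies in its closure. [folklore] -/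
theorem mem_closure_of_mapClusterPt {Y : ℝ → EuclideanSpace ℝ (Fin 3)} {S : Set (EuclideanSpace ℝ (Fin 3))}
    (hS : ∀ t, 0 ≤ t → Y t ∈ S) {z : EuclideanSpace ℝ (Fin 3)} (hz : MapClusterPt z atTop Y) :
    z ∈ closure S := by
  rw [mem_closure_iff_nhds]
  intro s hs
  have hfreq : ∃ᶠ t in atTop, Y t ∈ s := (mapClusterPt_iff_frequently.1 hz) s hs
  obtain ⟨t, hts, ht0⟩ := (hfreq.and_eventually (eventually_ge_atTop 0)).exists
  exact ⟨Y t, hts, hS t ht0⟩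

/-- **LIMIT-SET KILL.**  Let `(U, P)` be a `C²` self-similar Euler profile with `γ ≠ ½` and `Y` a
backward trajectory bounded for `t ≥ 0` through a VORTICAL point, `Ω(Y(0)) ≠ 0`.  Then `Y` has a
cluster point `z` which is a stagnation point carrying a unit `w` with `⟪DU(z)w, w⟫ ≥ 1`: a BAD node
(were every cluster node good, compactness of `B̄(0,B) × 𝕊²` would make the stretching along `Y`
eventually `≤ θ < 1`, and ORBIT KILL would give `Ω(Y(0)) = 0`).  No convergence of `Y` is assumed.
[cite: ConstantinIgnatovaVicol2026Putative, §3.5 proof of Thm 3.10 (trajectory-wise, sharpened; not in print)] -/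
theorem exists_mapClusterPt_stretching_ge_one (h : IsSelfSimilarEulerProfile γ c U P) (hγ' : γ ≠ 1 / 2)
    {Y : ℝ → EuclideanSpace ℝ (Fin 3)}
    (hY : ∀ t, HasDerivAt Y ((-1 : ℝ) • selfSimilarTransport γ c U (Y t)) t)
    {B : ℝ} (hB : ∀ t, 0 ≤ t → ‖Y t‖ ≤ B) (hΩ : curl U (Y 0) ≠ 0) :
    ∃ z ∈ selfSimilarNodalSet γ c U, ‖z‖ ≤ B ∧ MapClusterPt z atTop Y ∧
      ∃ w : EuclideanSpace ℝ (Fin 3), ‖w‖ = 1 ∧ 1 ≤ ⟪fderiv ℝ U z w, w⟫ := by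
  classical
  by_contra hcon
  push Not at hcon
  -- Step 1: the stretching along `Y` is NOT eventually subcritical (else ORBIT KILL)
  have hnot : ∀ n : ℕ, ∃ t : ℝ, (n : ℝ) ≤ t ∧ ∃ w : EuclideanSpace ℝ (Fin 3), ‖w‖ = 1 ∧
      1 - 1 / ((n : ℝ) + 1) < ⟪fderiv ℝ U (Y t) w, w⟫ := by
    intro n
    by_contra hn
    push Not at hn
    have hθ : (1 : ℝ) - 1 / ((n : ℝ) + 1) < 1 := by
      have : (0 : ℝ) < 1 / ((n : ℝ) + 1) := by positivity
      linarith
    refine hΩ (curl_comp_eq_zero_of_eventually_stretching_le h hY hB hθ (Nat.cast_nonneg n) ?_)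
    intro t ht w
    by_cases hw : w = 0
    · simp [hw]
    · have hwn : 0 < ‖w‖ := norm_pos_iff.2 hw
      set e : EuclideanSpace ℝ (Fin 3) := ‖w‖⁻¹ • w with he
      have he1 : ‖e‖ = 1 := by
        rw [he, norm_smul, norm_inv, norm_norm, inv_mul_cancel₀ hwn.ne']
      have h1 := hn t ht e he1
      have h2 : ⟪fderiv ℝ U (Y t) e, e⟫ = ‖w‖⁻¹ ^ 2 * ⟪fderiv ℝ U (Y t) w, w⟫ := by
        rw [he, map_smul, inner_smul_left, inner_smul_right]
        simp only [conj_trivial]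
        ring
      rw [h2] at h1
      have h3 : ‖w‖⁻¹ ^ 2 * ⟪fderiv ℝ U (Y t) w, w⟫ * ‖w‖ ^ 2 ≤ (1 - 1 / ((n : ℝ) + 1)) * ‖w‖ ^ 2 :=
        mul_le_mul_of_nonneg_right h1 (sq_nonneg _)
      have h4 : ‖w‖⁻¹ ^ 2 * ⟪fderiv ℝ U (Y t) w, w⟫ * ‖w‖ ^ 2 = ⟪fderiv ℝ U (Y t) w, w⟫ := by
        field_simp
      linarith
  choose t ht w hw1 hw2 using hnot
  -- Step 2: extract a convergent subsequence of `(Y (t n), w n)` in the compact `B̄(0,B) × 𝕊²`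
  set K : Set (EuclideanSpace ℝ (Fin 3) × EuclideanSpace ℝ (Fin 3)) :=
    closedBall 0 B ×ˢ sphere 0 1 with hK
  have hKc : IsCompact K := (isCompact_closedBall 0 B).prod (isCompact_sphere 0 1)
  have hmem : ∀ n, (Y (t n), w n) ∈ K := fun n =>
    ⟨mem_closedBall_zero_iff.2 (hB _ ((Nat.cast_nonneg n).trans (ht n))), by simp [hw1 n]⟩
  obtain ⟨⟨z, e⟩, ⟨hzB, he⟩, φ, hφ, hlim⟩ := hKc.tendsto_subseq hmem
  have hzB' : ‖z‖ ≤ B := mem_closedBall_zero_iff.1 hzB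
  have he1 : ‖e‖ = 1 := by simpa using he
  have hlim1 : Tendsto (fun n => Y (t (φ n))) atTop (𝓝 z) :=
    (continuous_fst.tendsto _).comp hlim
  -- `z` is a cluster point of `Y`
  have htφ : Tendsto (fun n => t (φ n)) atTop atTop := by
    refine tendsto_atTop_mono (fun n => ht (φ n)) ?_
    exact tendsto_natCast_atTop_atTop.comp hφ.tendsto_atTop
  have hcl : MapClusterPt z atTop Y := by
    rw [mapClusterPt_iff_frequently]
    intro s hs
    have hev : ∀ᶠ n in atTop, Y (t (φ n)) ∈ s := hlim1 hs
    rw [frequently_atTop]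
    intro a
    obtain ⟨n, hn⟩ := (hev.and (htφ.eventually (eventually_ge_atTop a))).exists
    exact ⟨t (φ n), hn.2, hn.1⟩
  have hzN : z ∈ selfSimilarNodalSet γ c U := mem_nodalSet_of_mapClusterPt h hγ' hY hB hcl
  -- Step 3: by continuity the stretching at `(z, e)` is `≥ 1`, contradicting goodness of `z`
  have hge : 1 ≤ ⟪fderiv ℝ U z e, e⟫ := by
    have hF := ((continuous_stretchingForm h).tendsto (z, e)).comp hlim
    have hlow : Tendsto (fun n : ℕ => 1 - (((φ n : ℕ) : ℝ) + 1)⁻¹) atTop (𝓝 1) := by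
      have h1 : Tendsto (fun n : ℕ => ((φ n : ℕ) : ℝ) + 1) atTop atTop :=
        tendsto_atTop_add_const_right _ _ (tendsto_natCast_atTop_atTop.comp hφ.tendsto_atTop)
      have h2 := h1.inv_tendsto_atTop
      simpa using (tendsto_const_nhds (x := (1 : ℝ))).sub h2
    refine le_of_tendsto_of_tendsto hlow hF (Eventually.of_forall fun n => ?_)
    have := hw2 (φ n)
    simp only [Function.comp_apply, one_div] at this ⊢
    exact this.le
  have := hcon z hzN hzB' hcl e he1
  linarith

/-! ### Vortical nodes are bad; the far-field corollary -/

/-- **A vortical stagnation point is a bad node**: `DU(z)Ω(z) = Ω(z)` (the vorticity equation (3.4) at a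
zero of `V`, CIV Thm 3.8), so `w = Ω(z)/|Ω(z)|` has `⟪DU(z)w, w⟫ = 1`. [cite: ConstantinIgnatovaVicol2026Putative, §3.5 Thm 3.8] -/
theorem exists_unit_stretching_eq_one_of_mem_nodalSet_of_curl_ne_zero
    (h : IsSelfSimilarEulerProfile γ c U P) {z : EuclideanSpace ℝ (Fin 3)}
    (hz : z ∈ selfSimilarNodalSet γ c U) (hΩ : curl U z ≠ 0) :
    ∃ w : EuclideanSpace ℝ (Fin 3), ‖w‖ = 1 ∧ ⟪fderiv ℝ U z w, w⟫ = 1 := by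
  have hV := h.isSelfSimilarEulerVorticityProfile
  have hn : ‖curl U z‖ ≠ 0 := norm_ne_zero_iff.2 hΩ
  refine ⟨‖curl U z‖⁻¹ • curl U z, ?_, ?_⟩
  · rw [norm_smul, norm_inv, norm_norm, inv_mul_cancel₀ hn]
  · rw [map_smul, hV.fderiv_apply_curl_eq_of_mem_nodalSet hz, inner_smul_left, inner_smul_right,
      real_inner_self_eq_norm_sq]
    simp only [conj_trivial]
    field_simp

/-- **Every vortical fluid particle is backward-asymptotic to a bad stagnation point adherent to the
vortical region** (`γ > 0`, `γ ≠ ½`, far field (3.8)).  For the global self-similar Lagrangian flow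
`Φ` of `V` and a point `x` with `Ω(x) ≠ 0`: the backward trajectory `t ↦ Φ_{−t}(x)` is bounded
(`backward_orbit_bounded`), stays in `{Ω ≠ 0}` (flow invariance), and has a cluster point `z ∈ 𝒩_V` with a
unit `w`, `⟪DU(z)w, w⟫ ≥ 1`, and `z ∈ closure {Ω ≠ 0}`.
[cite: ConstantinIgnatovaVicol2026Putative, §3.5 proof of Thm 3.10 (trajectory-wise, sharpened; not in print)] -/
theorem exists_badNode_mapClusterPt_of_curl_ne_zero (h : IsSelfSimilarEulerProfile γ c U P)
    (hγ : 0 < γ) (hγ' : γ ≠ 1 / 2) (hfar : HasSelfSimilarFarFieldWith γ c C U) {K : ℝ≥0}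
    (hK : LipschitzWith K (selfSimilarTransport γ c U)) {x : EuclideanSpace ℝ (Fin 3)}
    (hx : curl U x ≠ 0) :
    ∃ z ∈ selfSimilarNodalSet γ c U, MapClusterPt z atTop (fun t => lipschitzFlow hK x (-t)) ∧
      (∃ w : EuclideanSpace ℝ (Fin 3), ‖w‖ = 1 ∧ 1 ≤ ⟪fderiv ℝ U z w, w⟫) ∧
      z ∈ closure {y | curl U y ≠ 0} := by
  have hY := hasDerivAt_backwardFlow hK x
  obtain ⟨B, hB⟩ := backward_orbit_bounded hγ hfar hY
  have hx0 : curl U (lipschitzFlow hK x (-0)) ≠ 0 := by simpa using hx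
  obtain ⟨z, hzN, -, hcl, w, hw1, hw⟩ := exists_mapClusterPt_stretching_ge_one h hγ' hY hB hx0
  refine ⟨z, hzN, hcl, ⟨w, hw1, hw⟩, ?_⟩
  -- the trajectory stays vortical
  have hstay : ∀ t, 0 ≤ t → lipschitzFlow hK x (-t) ∈ {y | curl U y ≠ 0} := by
    intro t ht hzero
    exact hx0 (curl_comp_eq_zero_of_curl_comp_eq_zero h hY hB ht hzero)
  exact mem_closure_of_mapClusterPt hstay hcl

end Summit.NavierStokesRegularity.NavierStokesRegularity.Theorems.PowerGaugeEulerLiouville.NodalContinuum
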